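import Literature.Analysis.FluidPDE.BeltramiFlows
import HarnessLib

/-!
# Barrier: velocity–vorticity alignment is not a growth engine — perfectly aligned (Beltrami)
# flows are exact Navier–Stokes solutions and decay

Barrier catalogue entry for `NavierStokesRegularity` (D-0021), METHOD LEVEL, everything PROVED
(zero fact debt), written for the ns-claims map (D-0090) row C139 and the T6/T3 «alignment»
technique family. A recurring blow-up mechanism reads: «if the velocity is (almost) aligned with
the vorticity on the region where `|u|` is maximal, then the maximum `R(t) = ‖u(t)‖_∞` obeys a
Riccati law `dR/dt ≥ c₀ R²` (hence blows up)» — steps of the shape of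
`Literature.Claims.NS.Gnayoro2026.Step8_P54` / `Step10_C63` (Prop 5.4 (5.4) p. 6, Cor 6.3 (6.3)
p. 7 of that text). The kernel facts below defeat every such law at once:

* the **viscous single-mode Beltrami wave** `u(t, x) = a e^{−νt} (sin x₃, cos x₃, 0)`,
  `p = −½ a² e^{−2νt}` — the tree's `strongBeltramiVelocity ν 1 (abc a 0 0)` (Majda–Bertozzi,
  §2.3.2, Example 2.8 with `(A, B, C) = (a, 0, 0)`, and p. 61: "the explicit solution is
  `v^ν(x,t) = e^{−λ̄²νt} v⁰(x)`") — is a classical solution of the unforced system on `ℝ³ × ℝ`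
  for EVERY viscosity `ν`, `2π`-periodic in every coordinate direction
  (`AlignmentDecay.isClassicalNSSolutionOn_wave`, `AlignmentDecay.wave_periodic`);
* it is **perfectly aligned at every point and every time**: `curl u(t) = u(t)`
  (`AlignmentDecay.curl_wave`), so `⟪u, ω⟫ = ‖u‖ ‖ω‖` and `ω ≠ 0` wherever `a ≠ 0`
  (`AlignmentDecay.inner_wave_curl`, `AlignmentDecay.curl_wave_ne_zero`);
* its speed is **spatially constant and exponentially decaying**: `‖u(t, x)‖ = |a| e^{−νt}` for
  all `x` (`AlignmentDecay.norm_wave`), so the maximum region is all of space, `R(t) = |a| e^{−νt}`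
  (`AlignmentDecay.iSup_norm_wave`) and `dR/dt = −ν R(t) < 0` (`AlignmentDecay.hasDerivAt_R`);
* hence (`AlignmentDecay.no_nondecrease_law`, `AlignmentDecay.no_riccati_law`) the universal
  laws «aligned (even exactly Beltrami) datum ⇒ `‖u(t)‖_∞` does not decrease» and «persistent
  perfect alignment ⇒ `c R(t)² ≤ dR/dt` for some `c > 0`» are FALSE over classical solutions on
  `ℝ³ × [0, ∞)` for every `ν > 0` — the Riccati law already fails at `t > 0` arbitrary.

The mechanism (Majda–Bertozzi, Prop. 2.10): alignment `curl v = λ v` is the Beltrami condition,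
under which `(v·∇)v = ∇(|v|²/2)` is a gradient absorbed by the pressure, so the viscous flow is
the decaying Stokes (heat) flow `e^{−λ²νt} v`. Alignment DEPLETES the Lamb vector `ω × u`; it does
not feed `‖u‖_∞`. (The companion entries `BeltramiNonlinearity` — «the nonlinearity / ∇p do not
vanish on Beltrami data», ABC point values — and `ExactModeLineDecayLaws` — decay laws on the
Stokes shear-mode line — use the same family for different claimed steps.)

## Structured block

technique_class: velocity-vorticity-alignment-growth riccati-supnorm-growth maximum-region-alignment
  alignment-propagation-blowup lamb-vector-depletion-misread
blocks: every law asserted for ALL classical (or all `2π`-periodic classical) solutions of the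
  unforced system with `ν > 0` of the shapes (α) «`⟪u₀, ω₀⟫ = ‖u₀‖‖ω₀‖` (or `curl u₀ = λu₀`) on
  the maximum region ⇒ `t ↦ ‖u(t)‖_∞` non-decreasing / bounded below by `‖u₀‖_∞`», (β) «alignment
  persists ⇒ `dR/dt ≥ c R² − (lower order)` with `R = ‖u‖_∞`», (γ) «`Φ(t) ≥ 1 − ε` ⇒ `|Ωₜ| ≳ R⁻³`
  and `Ωₜ ⊂ B(xₜ, 1/(2R))`» (on the wave `Ωₜ = ℝ³`); adjudicated instance: C139 `Gnayoro2026`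
  Steps 6–10 / 12 (locator of record there is the datum item Prop 2.2 (1); this is the §2 method
  cell) [cite: MajdaBertozziCUP2002, §2.3.2 Example 2.8 eq. (2.49), Prop. 2.10, p. 61].
because: for a Beltrami field `curl v = v` the viscous solution is `e^{−νt} v` exactly
  (`isClassicalNSSolutionOn_strongBeltrami`), which stays Beltrami, keeps
  `|u(t,x)| = e^{−νt}|v(x)|`,
  and for the single mode `(sin x₃, cos x₃, 0)` has `|v| ≡ |a|`
  [cite: MajdaBertozziCUP2002, §2.3.2 p. 61].
evasions_known: (1) laws that use a quantity the wave does not saturate — e.g. genuine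
  CONCENTRATION (`|Ωₜ| → 0`, localisation of `|u|` near a point), strain–vorticity geometry beyond
  the direction of `u`, or lower bounds on the Lamb vector `ω × u` itself — are not touched;
  (2) regularity-direction criteria (Constantin–Fefferman: Lipschitz vorticity DIRECTION ⇒ no
  blow-up) point the SAME way as this entry (alignment/coherence is regularising) and are not in
  tension with it; (3) Euler (`ν = 0`): the wave is steady (`R` constant), so (α) survives in the
  weak form «non-increasing» but (β) still fails [cite: MajdaBertozziCUP2002, Prop. 2.10].
scope_caveats: unforced system, classical solutions in the tree sense `IsClassicalNSSolutionOn`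
  (time set `univ` or `Ici 0`); the witness has infinite energy on `ℝ³` (it is the `𝕋³` shear
  mode read on `ℝ³`), so laws whose class imposes finite energy on `ℝ³` are outside this entry's
  letter (the torus reading is immediate from `wave_periodic`) [cite: MajdaBertozziCUP2002, §2.3.2].
status: established; every conjunct proved below (`beltramiAlignmentDecay_holds`, standard axioms).

## References

* A. J. Majda, A. L. Bertozzi, *Vorticity and Incompressible Flow*, CUP 2002, §2.3.2
  Example 2.8 eq. (2.49) (ABC flows), Prop. 2.10 (Beltrami flows are steady Euler solutions with
  `p = −|v|²/2`), p. 61 (viscous decay `e^{−λ̄²νt}v`). [MajdaBertozziCUP2002]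

WHAT THIS IS NOT: not a claim about NS regularity or blow-up; not a claim about any author beyond
the typed locator.
-/

noncomputable section

open Real Set Function Filter Topology InnerProductSpace
open scoped RealInnerProductSpace

namespace Literature.Barriers.NavierStokesRegularity.AlignmentDecay

open Literature.Analysis.FluidPDE Literature.Analysis.FluidPDE.ABC

/-- The viscous single-mode Beltrami wave `u(t,x) = a e^{−νt}(sin x₃, cos x₃, 0)`: the tree's
strong-Beltrami viscous flow built on `abc a 0 0`.
[cite: MajdaBertozziCUP2002, §2.3.2 Example 2.8 eq. (2.49) and p. 61] -/
abbrev wave (ν a : ℝ) : ℝ → EuclideanSpace ℝ (Fin 3) → EuclideanSpace ℝ (Fin 3) :=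
  strongBeltramiVelocity ν 1 (abc a 0 0)

/-- Its Bernoulli pressure `p(t,x) = −½ e^{−2νt} |abc a 0 0 (x)|²`.
[cite: MajdaBertozziCUP2002, §2.3.2 p. 61] -/
abbrev wavePressure (ν a : ℝ) : ℝ → EuclideanSpace ℝ (Fin 3) → ℝ :=
  strongBeltramiPressure ν 1 (abc a 0 0)

/-- The wave is a classical Navier–Stokes solution on `ℝ³ × ℝ` for every viscosity.
[cite: MajdaBertozziCUP2002, §2.3.2 p. 61] -/
theorem isClassicalNSSolutionOn_wave (ν a : ℝ) :
    IsClassicalNSSolutionOn univ ν 0 (wave ν a) (wavePressure ν a) :=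
  isClassicalNSSolutionOn_abc a 0 0 ν

/-- … hence on the forward time set `[0, ∞)`. [cite: MajdaBertozziCUP2002, §2.3.2 p. 61] -/
theorem isClassicalNSSolutionOn_wave_Ici (ν a : ℝ) :
    IsClassicalNSSolutionOn (Ici 0) ν 0 (wave ν a) (wavePressure ν a) :=
  (isClassicalNSSolutionOn_wave ν a).mono (subset_univ _) (uniqueDiffOn_Ici 0)

/-- Closed form: `u(t,x) = e^{−νt} · abc a 0 0 (x)`. [cite: MajdaBertozziCUP2002, §2.3.2 p. 61] -/
theorem wave_apply (ν a t : ℝ) (x : EuclideanSpace ℝ (Fin 3)) :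
    wave ν a t x = exp (-(ν * t)) • abc a 0 0 x :=
  strongBeltramiVelocity_abc a 0 0 ν t x

/-- The single mode has constant speed: `‖abc a 0 0 (x)‖ = |a|` (`sin² + cos² = 1`).
[cite: MajdaBertozziCUP2002, §2.3.2 Example 2.8 eq. (2.49)] -/
theorem norm_abc_mode (a : ℝ) (x : EuclideanSpace ℝ (Fin 3)) : ‖abc a 0 0 x‖ = |a| := by
  have hsq : ‖abc a 0 0 x‖ ^ 2 = a ^ 2 := by
    rw [EuclideanSpace.norm_sq_eq, Fin.sum_univ_three, abc_apply_zero, abc_apply_one, abc_apply_two]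
    simp only [zero_mul, add_zero, Real.norm_eq_abs, sq_abs]
    nlinarith [sin_sq_add_cos_sq (x 2)]
  have h := congrArg Real.sqrt hsq
  rwa [Real.sqrt_sq (norm_nonneg _), Real.sqrt_sq_eq_abs] at h

/-- **Spatially constant, exponentially decaying speed**: `‖u(t,x)‖ = |a| e^{−νt}` for all `x`.
[cite: MajdaBertozziCUP2002, §2.3.2 p. 61] -/
theorem norm_wave (ν a t : ℝ) (x : EuclideanSpace ℝ (Fin 3)) :
    ‖wave ν a t x‖ = |a| * exp (-(ν * t)) := by
  rw [wave_apply, norm_smul, Real.norm_of_nonneg (exp_pos _).le, norm_abc_mode, mul_comm]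

/-- The sup norm `R(t) = ⨆ₓ ‖u(t,x)‖ = |a| e^{−νt}` (attained everywhere: the maximum region is all
of space). [cite: MajdaBertozziCUP2002, §2.3.2 p. 61] -/
theorem iSup_norm_wave (ν a t : ℝ) : (⨆ x, ‖wave ν a t x‖) = |a| * exp (-(ν * t)) := by
  simp_rw [norm_wave]
  exact ciSup_const

/-- **Perfect alignment at every point and time**: `curl u(t) = u(t)` (the viscous flow of a
Beltrami field stays Beltrami with the same eigenvalue).
[cite: MajdaBertozziCUP2002, §2.3.2 Example 2.8 and Prop. 2.10] -/
theorem curl_wave (ν a t : ℝ) (x : EuclideanSpace ℝ (Fin 3)) :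
    curl (wave ν a t) x = wave ν a t x := by
  have h1 : wave ν a t = fun y => exp (-(ν * t)) • abc a 0 0 y := funext (wave_apply ν a t)
  rw [h1, curl_const_smul ((differentiable_abc a 0 0) x), curl_abc]

/-- Alignment as printed: `⟪u, ω⟫ = ‖u‖ ‖ω‖` at every point and time.
[cite: MajdaBertozziCUP2002, Prop. 2.10] -/
theorem inner_wave_curl (ν a t : ℝ) (x : EuclideanSpace ℝ (Fin 3)) :
    ⟪wave ν a t x, curl (wave ν a t) x⟫ = ‖wave ν a t x‖ * ‖curl (wave ν a t) x‖ := by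
  rw [curl_wave, real_inner_self_eq_norm_sq, sq]

/-- The vorticity never vanishes (for `a ≠ 0`), so the alignment is not a vacuous statement.
[cite: MajdaBertozziCUP2002, Prop. 2.10] -/
theorem curl_wave_ne_zero (ν t : ℝ) {a : ℝ} (ha : a ≠ 0) (x : EuclideanSpace ℝ (Fin 3)) :
    curl (wave ν a t) x ≠ 0 := by
  rw [curl_wave, ← norm_ne_zero_iff, norm_wave]
  exact mul_ne_zero (abs_ne_zero.2 ha) (exp_pos _).ne'

/-- `2π`-periodicity in every coordinate direction (the wave is the `𝕋³` shear mode read on `ℝ³`).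
[cite: MajdaBertozziCUP2002, §2.3.2 Example 2.8 eq. (2.49)] -/
theorem wave_periodic (ν a t : ℝ) (x : EuclideanSpace ℝ (Fin 3)) (i : Fin 3) :
    wave ν a t (x + EuclideanSpace.single i (2 * π)) = wave ν a t x := by
  rw [wave_apply, wave_apply]
  congr 1
  ext j
  fin_cases i <;> fin_cases j <;>
    simp [abc, sin_add_two_pi, cos_add_two_pi]

/-- `R(t) = |a| e^{−νt}` is differentiable with `dR/dt = −ν R(t)`.
[cite: MajdaBertozziCUP2002, §2.3.2 p. 61] -/
theorem hasDerivAt_R (ν a t : ℝ) :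
    HasDerivAt (fun s => ⨆ x, ‖wave ν a s x‖) (-(ν * (|a| * exp (-(ν * t))))) t := by
  have h1 : (fun s => ⨆ x, ‖wave ν a s x‖) = fun s => |a| * exp (-(ν * s)) :=
    funext fun s => iSup_norm_wave ν a s
  rw [h1]
  have h0 : HasDerivAt (fun s : ℝ => ν * s) ν t := by
    simpa using (hasDerivAt_id t).const_mul ν
  have h2 : HasDerivAt (fun s : ℝ => -(ν * s)) (-ν) t := h0.neg
  have h3 := (h2.exp).const_mul |a|
  exact h3.congr_deriv (by ring)

/-- **No «aligned datum ⇒ no decay» law**: for every `ν > 0` it is false that every classical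
solution on `ℝ³ × [0, ∞)` with Beltrami (perfectly aligned) initial vorticity `curl u₀ = u₀` keeps
`‖u(t)‖_∞ ≥ ‖u₀‖_∞` (the wave with `a = 1` has `R(1) = e^{−ν} < 1 = R(0)`).
[cite: MajdaBertozziCUP2002, §2.3.2 p. 61] -/
theorem no_nondecrease_law {ν : ℝ} (hν : 0 < ν) :
    ¬ ∀ (u : ℝ → EuclideanSpace ℝ (Fin 3) → EuclideanSpace ℝ (Fin 3))
        (p : ℝ → EuclideanSpace ℝ (Fin 3) → ℝ), IsClassicalNSSolutionOn (Ici 0) ν 0 u p →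
        (∀ x, curl (u 0) x = u 0 x) → ∀ t, 0 ≤ t → (⨆ x, ‖u 0 x‖) ≤ ⨆ x, ‖u t x‖ := by
  intro h
  have h1 := h (wave ν 1) (wavePressure ν 1) (isClassicalNSSolutionOn_wave_Ici ν 1)
    (curl_wave ν 1 0) 1 zero_le_one
  rw [iSup_norm_wave, iSup_norm_wave] at h1
  have h2 : exp (-(ν * 1)) < exp (-(ν * 0)) := exp_lt_exp.2 (by nlinarith)
  simp only [abs_one, one_mul] at h1
  linarith

/-- **No Riccati growth law under persistent perfect alignment**: there is no `c > 0` such that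
for every `ν > 0` and every classical solution on `ℝ³ × [0, ∞)` aligned at all times
(`⟪u, ω⟫ = ‖u‖‖ω‖` everywhere), `c R(t)² ≤ dR/dt` for `t > 0`, `R(t) = ⨆ₓ ‖u(t,x)‖` — on the wave
`dR/dt = −νR < 0 < cR²`. This is the shape of the printed laws (5.4)/(6.3) of the C139 text.
[cite: MajdaBertozziCUP2002, §2.3.2 p. 61] -/
theorem no_riccati_law :
    ¬ ∃ c : ℝ, 0 < c ∧ ∀ ν : ℝ, 0 < ν →
        ∀ (u : ℝ → EuclideanSpace ℝ (Fin 3) → EuclideanSpace ℝ (Fin 3))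
          (p : ℝ → EuclideanSpace ℝ (Fin 3) → ℝ), IsClassicalNSSolutionOn (Ici 0) ν 0 u p →
          (∀ t, 0 ≤ t → ∀ x, ⟪u t x, curl (u t) x⟫ = ‖u t x‖ * ‖curl (u t) x‖) →
          ∀ t, 0 < t → c * (⨆ x, ‖u t x‖) ^ 2 ≤ deriv (fun s => ⨆ x, ‖u s x‖) t := by
  rintro ⟨c, hc, h⟩
  have h1 := h 1 one_pos (wave 1 1) (wavePressure 1 1) (isClassicalNSSolutionOn_wave_Ici 1 1)
    (fun t _ x => inner_wave_curl 1 1 t x) 1 one_pos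
  rw [(hasDerivAt_R 1 1 1).deriv, iSup_norm_wave] at h1
  simp only [abs_one, one_mul] at h1
  have hpos : 0 < exp (-1 : ℝ) := exp_pos _
  have hc2 : 0 < c * exp (-1 : ℝ) ^ 2 := mul_pos hc (pow_pos hpos 2)
  linarith

end Literature.Barriers.NavierStokesRegularity.AlignmentDecay

namespace Literature.Barriers.NavierStokesRegularity

open Literature.Analysis.FluidPDE Literature.Barriers.NavierStokesRegularity.AlignmentDecay

/-- **BARRIER `BeltramiAlignmentDecay` — «alignment is not a growth engine».** Conjunction of the
kernel facts of this file: (i) for every `ν, a` the single-mode Beltrami wave is a classical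
solution on `ℝ³ × ℝ`, `2π`-periodic, with `curl u = u`, `⟪u, ω⟫ = ‖u‖‖ω‖` and
`‖u(t,x)‖ = |a|e^{−νt}` at every point and time; (ii) for every `ν > 0` the law «Beltrami datum ⇒
`‖u(t)‖_∞ ≥ ‖u₀‖_∞`» over classical solutions on `[0, ∞)` is false; (iii) there is no `c > 0`
making «persistent perfect alignment ⇒ `c R² ≤ dR/dt`» a law. See the module docstring for the
structured block (technique_class / blocks / because / evasions_known / scope_caveats / status).
[cite: MajdaBertozziCUP2002, §2.3.2 Example 2.8 eq. (2.49), Prop. 2.10 and p. 61] -/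
def BeltramiAlignmentDecay : Prop :=
  (∀ ν a : ℝ,
      IsClassicalNSSolutionOn univ ν 0 (wave ν a) (wavePressure ν a) ∧
        (∀ (t : ℝ) (x : EuclideanSpace ℝ (Fin 3)) (i : Fin 3),
            wave ν a t (x + EuclideanSpace.single i (2 * π)) = wave ν a t x) ∧
          (∀ (t : ℝ) (x : EuclideanSpace ℝ (Fin 3)), curl (wave ν a t) x = wave ν a t x) ∧
            (∀ (t : ℝ) (x : EuclideanSpace ℝ (Fin 3)),
                ⟪wave ν a t x, curl (wave ν a t) x⟫ = ‖wave ν a t x‖ * ‖curl (wave ν a t) x‖) ∧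
              ∀ (t : ℝ) (x : EuclideanSpace ℝ (Fin 3)), ‖wave ν a t x‖ = |a| * exp (-(ν * t))) ∧
  (∀ ν : ℝ, 0 < ν →
      ¬ ∀ (u : ℝ → EuclideanSpace ℝ (Fin 3) → EuclideanSpace ℝ (Fin 3))
          (p : ℝ → EuclideanSpace ℝ (Fin 3) → ℝ), IsClassicalNSSolutionOn (Ici 0) ν 0 u p →
          (∀ x, curl (u 0) x = u 0 x) → ∀ t, 0 ≤ t → (⨆ x, ‖u 0 x‖) ≤ ⨆ x, ‖u t x‖) ∧
  (¬ ∃ c : ℝ, 0 < c ∧ ∀ ν : ℝ, 0 < ν →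
      ∀ (u : ℝ → EuclideanSpace ℝ (Fin 3) → EuclideanSpace ℝ (Fin 3))
        (p : ℝ → EuclideanSpace ℝ (Fin 3) → ℝ), IsClassicalNSSolutionOn (Ici 0) ν 0 u p →
        (∀ t, 0 ≤ t → ∀ x, ⟪u t x, curl (u t) x⟫ = ‖u t x‖ * ‖curl (u t) x‖) →
        ∀ t, 0 < t → c * (⨆ x, ‖u t x‖) ^ 2 ≤ deriv (fun s => ⨆ x, ‖u s x‖) t)

/-- **Discharge**: every conjunct of `BeltramiAlignmentDecay` is a theorem of this file.
[cite: MajdaBertozziCUP2002, §2.3.2 Example 2.8 eq. (2.49), Prop. 2.10 and p. 61] -/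
theorem beltramiAlignmentDecay_holds : BeltramiAlignmentDecay :=
  ⟨fun ν a => ⟨isClassicalNSSolutionOn_wave ν a, wave_periodic ν a, curl_wave ν a,
      inner_wave_curl ν a, norm_wave ν a⟩,
    fun _ hν => no_nondecrease_law hν, no_riccati_law⟩

end Literature.Barriers.NavierStokesRegularity
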